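import Summits.QuantumFields.BalabanUV.Beta.EriceFlowEnclosureB12AsPrintedPointwiseFading

/-!
# Beta / EriceFlowEnclosureB12AsPrintedPointwiseFadingOrder — WHAT (0.31) FORCES POINTWISE, part 7: UNDER FADING MEMORY, ORDER IS FREE.  Two runs of
# (0.20) of the SAME length inside a small box ]0, γ], for a history-dependent β carrying node U2's COUPLING-CHART moduli `T4CouplingMatching.HistLipschitz Λ γ β`
# with `FadingMemory C θ Λ`, 0 ≤ θ < 1, and `4Cγ³ ≤ (1 − θ)²`: the signed discrepancy Δ_k := 1∕g_k² − 1∕g′_k² CANNOT CONTRACT FASTER THAN ρ := (1 + θ)∕2 PER STEP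
# (Δ_{k+1} ≥ ρ Δ_k once Δ_0 > 0) — so the ORDER of the bare couplings is the order of EVERY effective coupling, the endpoint map g₀ ↦ g_K is STRICTLY
# INCREASING, and same-length runs pinned at one renormalized coupling COINCIDE: uniqueness of «g₀ = g₀(ε, g)» with NO asymptotic-freedom letter, NO sign, NO
# upper bound, NO (0.31), NO Theorem 2 and NO uniform reading — prover 1's `runs_eq_of_fadingMemory` (gen 33, #61e: AF letter `BetaLowerH b` + smallness
# C(γ³ + 2γ∕b) ≤ (1 − θ)∕2 via node U2's `twoSided_fixedPoint`) and part 6's `localUnique_of_fadingMemory` (gen 43, #60b: Theorem 2's own (0.31) along the tuned run)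
# lose their positivity inputs altogether; θ = 0 is allowed and recovers prover 1's last-only `runs_eq_of_lastOnly` up to the constant
# (β-flow team, prover 2 = lower ∕ positivity side, unit `b2b-balaban-beta-bflow-p2`, gen 44; ROW AP-I × node U2's letters; answers the unit's gen-43 OPEN (b) «is
# the g-UNIFORM reading of (0.31) load-bearing for uniqueness under fading memory, as it is for SIZE (#59e)?» — NO; companion `…PointwiseFadingOrderEnd`)

HONEST FRAMING (page 1 of everything the β sub-cell writes): discharging `BetaPertH` makes Bałaban's UV stability UNCONDITIONAL — a
real constructive-QFT result; it is NOT the continuum limit and NOT the Clay problem.  HONEST DEPENDENCY (cell reorg 2026-08-19,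
verbatim): «continuum YM on T⁴ ⇐ BetaPertH ∧ nine spine estimates (0/9 proved); BetaPertH ⇐ (D1) ∧ (D4) ∧ CAP+tail; G-an2-4 gates
asym, D1 and NE2/3/4.»  THIS MODULE DISCHARGES NOTHING: §1 is elementary real analysis about two real sequences obeying the recursion
(0.20) of [I] = T. Bałaban, Commun. Math. Phys. **109** (1987) [Balaban1987RG1] p. 256 for an ABSTRACT history-dependent family `β : FlowStep.HBeta`
(p. 298: β_j *"depends also on all preceding coupling constants"*) under node U2's HYPOTHESIS SHAPES `HistLipschitz` ∕ `FadingMemory` — NOT printed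
(GAPS G-t4-U2-2) —; §2 reads §1 on the statement-exact carrier `B12BetaAsPrinted` through the printed `Definitions` ((0.18): a run starts at its
bare coupling) and, for the END, `Theorem2Statement` (Theorem 2 is STATED WITHOUT PROOF, p. 259; [Balaban1989LargeFieldII] p. 355) as a
HYPOTHESIS.  Uniqueness of g₀ is NOT printed in [I] (custodian's `beta/asprinted/DELTA-I.md` D-21: Theorem 2 is an existence statement, the
tree types `∃`); where it holds it is the consumer's theorem under the consumer's modulus — here: the fading-memory moduli ALONE.

THE POINT.  Prover 1 (#61e) and part 6 (#60b) prove same-length uniqueness BACKWARD from the infrared pin g_K = g′_K: δ_j ≤ δ_{j+1} + Σ_{i≤j} Λ j i·g_i²g′_i·δ_i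
with δ_K = 0 is a two-point problem, closed by a sup-norm contraction whose constant is the TOTAL AF weight Σ_i g_i² g′_i — hence an AF letter (#61e)
or Theorem 2's (0.31) along the tuned run (#60b), and at θ = 1 the contraction genuinely fails beyond depth ≍ b³∕C² (prover 1 gen 34, #62d
`not_runs_eq_uniform_allDepths`).  READ THE SAME RECURSION FORWARD from the ultraviolet end instead, SIGNED: Δ_{k+1} = Δ_k − (β_{k+1}(g_{≤k}) − β_{k+1}(g′_{≤k}))
(§1 `signed_step`), |β_{k+1}(g_{≤k}) − β_{k+1}(g′_{≤k})| ≤ Σ_{i≤k} Cθ^{k−i}·γ³·|Δ_i|.  If the chain Δ_{j+1} ≥ ρΔ_j (ρ := (1+θ)∕2 ∈ ]θ, 1[) holds below k and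
Δ_0 > 0, then 0 < Δ_i ≤ ρ^{−(k−i)}Δ_k, the feedback is ≤ Cγ³Δ_k Σ_{d≥0}(θ∕ρ)^d = Cγ³Δ_k(1+θ)∕(1−θ), and Δ_{k+1} ≥ Δ_k(1 − Cγ³(1+θ)∕(1−θ)) ≥ ρΔ_k as soon as
2Cγ³(1+θ) ≤ (1−θ)² (§1 **`sep_geometric`**, by strong induction).  The geometric fading θ < 1 beats any contraction of the discrepancy: NO WEIGHT SUM, hence NO
ASYMPTOTIC FREEDOM, is needed, at ANY depth K.  Consequences (§1): Δ_j ≥ ρ^j Δ_0 > 0, g_j < g′_j at every scale, forward uniqueness, and pinned same-length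
runs coincide — prover 1's `runs_eq_of_fadingMemory` with `BetaLowerH b`, the weight-sum bound and its b-dependent smallness REMOVED and 0 ≤ θ; (§2) on the
carrier: bare-coupling uniqueness and strict monotonicity, part 5's local-uniqueness hypothesis `huniq` from `Definitions` + prover 1's binder `hrg` + the
moduli ALONE (part 6's `exists_localUnique_of_fadingMemory` WITHOUT its tuned-run carrier, i.e. without Theorem 2), and the END: `Theorem2Statement S hL` AS TYPED
(«∃ β, β′» AFTER «∀ g», `Missing.B12Thm2Shape`) + `Definitions` + (U) (only to put (0.20) on in-interval runs) + the moduli ⟹ «∃! g₀» — prover 1's END (#61e)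
WITHOUT `BetaLowerH b`, part 6′'s (#60d) WITHOUT the uniform reading `hTu`.  ANSWER to gen-43 OPEN (b): the placement of «there exist constants β, β′» (p. 259)
is load-bearing for the SIZE of β near zero coupling (#59e `typed_theorem2_not_uniform`) and NOT for the uniqueness of g₀ under fading memory; against
prover 1's θ = 1 witnesses (#62d∕#62f: AF letter PRESENT, uniqueness FAILS) the rate θ < 1 — not asymptotic freedom — is the exact load-bearing letter.

WHAT THIS FILE PROVES (0 sorry, 0 def): §1 (any `β : HBeta`) `signed_step`, `le_of_chain`, **`sep_geometric`**, `sep_lower`, **`order_preserved`**,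
`fwd_unique`, **`runs_eq_of_fadingMemory_signFree`**, `bare_lt_iff_end_lt`; §2 (carrier) **`bareCoupling_unique_signFree`**, **`bareCoupling_strictMono`**,
`bare_lt_iff_renormalized_lt`, **`localUnique_signFree`**, **`theorem2_existsUnique_of_fadingMemory_signFree`**.
NOT CLAIMED: any modulus, sign or bound for Bałaban's β; which reading print intends; Theorem 2; `BetaPertH`; continuum; Clay.
-/

namespace Summit.QuantumFields.BalabanUV.Beta.EriceFlowEnclosureB12AsPrintedPointwiseFadingOrder

open Finset
open Literature.MathematicalPhysics.QuantumFieldTheory.Balaban1983to89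
open Literature.MathematicalPhysics.QuantumFieldTheory.Balaban1983to89.B12BetaAsPrinted
open Literature.MathematicalPhysics.QuantumFieldTheory.Balaban1983to89.FlowStep (HBeta prefixOf Box mem_box box_mono RGEqH BetaUpperH)
open Literature.MathematicalPhysics.QuantumFieldTheory.Balaban1983to89.T4CouplingMatching (HistLipschitz FadingMemory abs_sub_le_of_inv_sq)
open Summit.QuantumFields.BalabanUV.Beta.EriceFlowEnclosureB12AsPrintedUpper (tunedRuns_of_theorem2Statement)
open Summit.QuantumFields.BalabanUV.Beta.EriceFlowEnclosureB12AsPrintedTunedUpper (hrg_of_betaUpperH)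
open Summit.QuantumFields.BalabanUV.Beta.EriceFlowEnclosureB12AsPrintedHistoryUniqueMono (geom_tail_le)

noncomputable section

/-! ## §1 Two same-length runs of (0.20) for ANY history-dependent β: the forward, signed discrepancy recursion under fading memory -/

section General

variable {β : HBeta}

/-- **THE SIGNED SAME-LENGTH STEP.**  Two runs g, g′ of (0.20) for the same history-dependent β, K steps, couplings in ]0, γ], coupling-chart moduli
`HistLipschitz Λ γ β` (Λ ≥ 0): with Δ_j := 1∕g_j² − 1∕g′_j², for j < K, `Δ_j − Σ_{i≤j} Λ j i·(g_i² g′_i)·|Δ_i| ≤ Δ_{j+1}` — (0.20) subtracted for the two runs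
(Δ_{j+1} = Δ_j − (β_{j+1}(g_{≤j}) − β_{j+1}(g′_{≤j}))), the moduli, and |g_i − g′_i| ≤ g_i²g′_i|Δ_i| (`T4CouplingMatching.abs_sub_le_of_inv_sq`); the signed
form of prover 1's `…HistoryUnique.hist_step`. [cite: Balaban1987RG1, (0.20) p.256 with p.298] -/
theorem signed_step {γ : ℝ} {Λ : ℕ → ℕ → ℝ} {K : ℕ} {g g' : ℕ → ℝ}
    (hg : RGEqH K β g) (hg' : RGEqH K β g')
    (hbox : ∀ i, i ≤ K → 0 < g i ∧ g i ≤ γ) (hbox' : ∀ i, i ≤ K → 0 < g' i ∧ g' i ≤ γ)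
    (hL : HistLipschitz Λ γ β) (hΛ : ∀ k i, i ≤ k → 0 ≤ Λ k i) {j : ℕ} (hj : j < K) :
    (1 / (g j) ^ 2 - 1 / (g' j) ^ 2)
        - ∑ i ∈ range (j + 1), Λ j i * ((g i) ^ 2 * g' i) * |1 / (g i) ^ 2 - 1 / (g' i) ^ 2|
      ≤ 1 / (g (j + 1)) ^ 2 - 1 / (g' (j + 1)) ^ 2 := by
  have e := hg j hj
  have e' := hg' j hj
  have hp : prefixOf g j ∈ Box γ j := T4CouplingMatching.prefixOf_mem_box hj.le hbox
  have hp' : prefixOf g' j ∈ Box γ j := T4CouplingMatching.prefixOf_mem_box hj.le hbox'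
  have h2 := hL j (prefixOf g j) (prefixOf g' j) hp hp'
  have h3 : ∑ i : Fin (j + 1), Λ j i * |prefixOf g j i - prefixOf g' j i|
      ≤ ∑ i ∈ range (j + 1), Λ j i * ((g i) ^ 2 * g' i) * |1 / (g i) ^ 2 - 1 / (g' i) ^ 2| := by
    rw [Finset.sum_range (fun i => Λ j i * ((g i) ^ 2 * g' i) * |1 / (g i) ^ 2 - 1 / (g' i) ^ 2|)]
    refine Finset.sum_le_sum fun i _ => ?_
    have hiK : (i : ℕ) ≤ K := by have := i.isLt; omega
    simp only [FlowStep.prefixOf_apply]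
    rw [mul_assoc]
    exact mul_le_mul_of_nonneg_left (abs_sub_le_of_inv_sq (hbox i hiK).1 (hbox' i hiK).1)
      (hΛ j i (Nat.lt_succ_iff.mp i.isLt))
  have key : 1 / g (j + 1) ^ 2 - 1 / g' (j + 1) ^ 2
      = (1 / g j ^ 2 - 1 / g' j ^ 2) - (β j (prefixOf g j) - β j (prefixOf g' j)) := by
    rw [e, e']; ring
  rw [key]
  have h4 := (le_abs_self (β j (prefixOf g j) - β j (prefixOf g' j))).trans (h2.trans h3)
  linarith

/-- A chain of one-step lower bounds integrates: if `ρ ≥ 0` and `ρ·Δ_j ≤ Δ_{j+1}` for all `j < n`, then `ρ^{n−i}·Δ_i ≤ Δ_n` for every `i ≤ n`. [folklore] -/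
theorem le_of_chain {Δ : ℕ → ℝ} {ρ : ℝ} (hρ : 0 ≤ ρ) :
    ∀ n : ℕ, (∀ j, j < n → ρ * Δ j ≤ Δ (j + 1)) → ∀ i, i ≤ n → ρ ^ (n - i) * Δ i ≤ Δ n := by
  intro n
  induction n with
  | zero => intro _ i hi; obtain rfl := Nat.le_zero.mp hi; simp
  | succ n ih =>
    intro hch i hi
    rcases lt_or_eq_of_le hi with hlt | rfl
    · have hin : i ≤ n := Nat.lt_succ_iff.mp hlt
      have h1 : ρ ^ (n - i) * Δ i ≤ Δ n := ih (fun j hj => hch j (Nat.lt_succ_of_lt hj)) i hin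
      have h2 : ρ * Δ n ≤ Δ (n + 1) := hch n (Nat.lt_succ_self n)
      rw [show n + 1 - i = (n - i) + 1 by omega, pow_succ', mul_assoc]
      exact (mul_le_mul_of_nonneg_left h1 hρ).trans h2
    · simp

/-- **FORWARD GEOMETRIC SEPARATION — THE DISCREPANCY CANNOT CONTRACT FASTER THAN ρ = (1+θ)∕2 PER STEP.**  Two runs g, g′ of (0.20) (`RGEqH K β`) of the
SAME length K for one history-dependent β, couplings in ]0, γ], coupling-chart moduli `HistLipschitz Λ γ β` with `FadingMemory C θ Λ` (0 ≤ θ < 1, 0 ≤ C) and the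
box smallness `4Cγ³ ≤ (1 − θ)²`; if the bare couplings are ordered, g_0 < g′_0, then for every j < K
`((1+θ)∕2)·(1∕g_j² − 1∕g′_j²) ≤ 1∕g_{j+1}² − 1∕g′_{j+1}²`.  (Strong induction on the chain: below step k the chain gives 0 < Δ_i ≤ ρ^{−(k−i)}Δ_k, so the
fading feedback Σ_{i≤k} Cθ^{k−i}γ³|Δ_i| is ≤ Cγ³Δ_k∕(1 − θ∕ρ) = Cγ³Δ_k(1+θ)∕(1−θ) ≤ (1 − ρ)Δ_k.)  NO asymptotic freedom, NO sign of β, NO upper bound, NO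
weight sum, ANY depth K. [cite: Balaban1987RG1, (0.20) p.256 with p.298] -/
theorem sep_geometric {γ θ C : ℝ} {Λ : ℕ → ℕ → ℝ} {K : ℕ} {g g' : ℕ → ℝ}
    (hθ0 : 0 ≤ θ) (hθ1 : θ < 1) (hC : 0 ≤ C) (hg : RGEqH K β g) (hg' : RGEqH K β g')
    (hbox : ∀ i, i ≤ K → 0 < g i ∧ g i ≤ γ) (hbox' : ∀ i, i ≤ K → 0 < g' i ∧ g' i ≤ γ)
    (hL : HistLipschitz Λ γ β) (hΛ : FadingMemory C θ Λ) (hsmall : 4 * C * γ ^ 3 ≤ (1 - θ) ^ 2)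
    (h0 : g 0 < g' 0) :
    ∀ j, j < K → (1 + θ) / 2 * (1 / (g j) ^ 2 - 1 / (g' j) ^ 2) ≤ 1 / (g (j + 1)) ^ 2 - 1 / (g' (j + 1)) ^ 2 := by
  set ρ : ℝ := (1 + θ) / 2 with hρ
  set Δ : ℕ → ℝ := fun j => 1 / (g j) ^ 2 - 1 / (g' j) ^ 2 with hΔ
  clear_value Δ ρ
  have hρpos : 0 < ρ := by rw [hρ]; linarith
  have hθρ : θ < ρ := by rw [hρ]; linarith
  have hq0 : 0 ≤ θ / ρ := div_nonneg hθ0 hρpos.le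
  have hq1 : θ / ρ < 1 := (div_lt_one hρpos).mpr hθρ
  have hg0 := hbox 0 (Nat.zero_le _)
  have hγ : 0 ≤ γ := le_trans hg0.1.le hg0.2
  have hCγ : 0 ≤ C * γ ^ 3 := by positivity
  -- the smallness in the form used by the step: C γ³ · (1/(1 − θ/ρ)) ≤ 1 − ρ
  have hkey : C * γ ^ 3 * (1 / (1 - θ / ρ)) ≤ 1 - ρ := by
    have h1 : 1 - θ / ρ = (1 - θ) / (1 + θ) := by
      rw [hρ]; field_simp; ring
    have h1θ : 0 < 1 - θ := by linarith
    rw [h1, one_div_div, show (1 : ℝ) - ρ = (1 - θ) / 2 by rw [hρ]; ring, mul_div_assoc', div_le_iff₀ h1θ]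
    nlinarith [mul_nonneg hCγ h1θ.le]
  -- Δ_0 > 0
  have hΔ0 : 0 < Δ 0 := by
    have := one_div_lt_one_div_of_lt (pow_pos hg0.1 2) (sq_lt_sq' (by linarith [hg0.1, (hbox' 0 (Nat.zero_le _)).1]) h0)
    simp only [hΔ]; linarith
  -- the chain up to n, for every n ≤ K
  have main : ∀ n, n ≤ K → ∀ j, j < n → ρ * Δ j ≤ Δ (j + 1) := by
    intro n
    induction n with
    | zero => intro _ j hj; exact absurd hj (Nat.not_lt_zero _)
    | succ n ih =>
      intro hn j hj
      have hnK : n < K := Nat.lt_of_succ_le hn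
      have hch : ∀ j, j < n → ρ * Δ j ≤ Δ (j + 1) := ih hnK.le
      rcases lt_or_eq_of_le (Nat.lt_succ_iff.mp hj) with hjn | rfl
      · exact hch j hjn
      · -- the new link ρ Δ_j ≤ Δ_{j+1}
        have hdom : ∀ i, i ≤ j → ρ ^ (j - i) * Δ i ≤ Δ j := le_of_chain hρpos.le j hch
        have hΔj : 0 < Δ j := lt_of_lt_of_le (mul_pos (pow_pos hρpos _) hΔ0) (hdom 0 (Nat.zero_le _))
        have hterm : ∀ i ∈ range (j + 1),
            Λ j i * ((g i) ^ 2 * g' i) * |Δ i| ≤ C * γ ^ 3 * Δ j * (θ / ρ) ^ (j + 1 - 1 - i) := by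
          intro i hi
          have hij : i ≤ j := Nat.lt_succ_iff.mp (mem_range.mp hi)
          have hiK : i ≤ K := hij.trans hnK.le
          have hΔi : 0 < Δ i := lt_of_lt_of_le (mul_pos (pow_pos hρpos _) hΔ0)
            (le_of_chain hρpos.le i (fun l hl => hch l (lt_of_lt_of_le hl hij)) 0 (Nat.zero_le _))
          have hpowpos : 0 < ρ ^ (j - i) := pow_pos hρpos _
          have hΔi_le : Δ i ≤ Δ j / ρ ^ (j - i) := by
            rw [le_div_iff₀ hpowpos, mul_comm]; exact hdom i hij
          have hw : (g i) ^ 2 * g' i ≤ γ ^ 3 := by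
            calc (g i) ^ 2 * g' i ≤ γ ^ 2 * γ := mul_le_mul (pow_le_pow_left₀ (hbox i hiK).1.le (hbox i hiK).2 2)
                  (hbox' i hiK).2 (hbox' i hiK).1.le (sq_nonneg γ)
              _ = γ ^ 3 := by ring
          have hw0 : 0 ≤ (g i) ^ 2 * g' i := mul_nonneg (sq_nonneg _) (hbox' i hiK).1.le
          have hΛi := hΛ j i hij
          rw [abs_of_pos hΔi, show j + 1 - 1 - i = j - i by omega]
          calc Λ j i * ((g i) ^ 2 * g' i) * Δ i
              ≤ C * θ ^ (j - i) * γ ^ 3 * (Δ j / ρ ^ (j - i)) :=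
                mul_le_mul (mul_le_mul hΛi.2 hw hw0 (by positivity)) hΔi_le hΔi.le (by positivity)
            _ = C * γ ^ 3 * Δ j * (θ / ρ) ^ (j - i) := by
                rw [div_pow]; ring
        have hsum : ∑ i ∈ range (j + 1), Λ j i * ((g i) ^ 2 * g' i) * |Δ i|
            ≤ C * γ ^ 3 * (1 / (1 - θ / ρ)) * Δ j := by
          calc ∑ i ∈ range (j + 1), Λ j i * ((g i) ^ 2 * g' i) * |Δ i|
              ≤ ∑ i ∈ range (j + 1), C * γ ^ 3 * Δ j * (θ / ρ) ^ (j + 1 - 1 - i) := Finset.sum_le_sum hterm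
            _ = C * γ ^ 3 * Δ j * ∑ i ∈ range (j + 1), (θ / ρ) ^ (j + 1 - 1 - i) := by rw [← Finset.mul_sum]
            _ = C * γ ^ 3 * Δ j * ∑ i ∈ range (j + 1), (θ / ρ) ^ i := by
                rw [Finset.sum_range_reflect (fun i => (θ / ρ) ^ i) (j + 1)]
            _ ≤ C * γ ^ 3 * Δ j * (1 / (1 - θ / ρ)) := by
                refine mul_le_mul_of_nonneg_left ?_ (mul_nonneg hCγ hΔj.le)
                have h := geom_tail_le hq0 hq1 0 (j + 1)
                simp only [Nat.Ico_zero_eq_range, Nat.sub_zero] at h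
                exact h
            _ = C * γ ^ 3 * (1 / (1 - θ / ρ)) * Δ j := by ring
        have hstep := signed_step hg hg' hbox hbox' hL (fun k i hik => (hΛ k i hik).1) hnK
        have hprod : C * γ ^ 3 * (1 / (1 - θ / ρ)) * Δ j ≤ (1 - ρ) * Δ j :=
          mul_le_mul_of_nonneg_right hkey hΔj.le
        simp only [hΔ] at hsum hprod hΔj ⊢
        nlinarith [hstep, hsum, hprod]
  intro j hj
  have h := main K le_rfl j hj
  simp only [hΔ] at h
  exact h

/-- Integrated form of `sep_geometric`: `((1+θ)∕2)^j·(1∕g_0² − 1∕g′_0²) ≤ 1∕g_j² − 1∕g′_j²` for every j ≤ K — the discrepancy stays POSITIVE at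
every scale and every depth. [cite: Balaban1987RG1, (0.20) p.256 with p.298] -/
theorem sep_lower {γ θ C : ℝ} {Λ : ℕ → ℕ → ℝ} {K : ℕ} {g g' : ℕ → ℝ}
    (hθ0 : 0 ≤ θ) (hθ1 : θ < 1) (hC : 0 ≤ C) (hg : RGEqH K β g) (hg' : RGEqH K β g')
    (hbox : ∀ i, i ≤ K → 0 < g i ∧ g i ≤ γ) (hbox' : ∀ i, i ≤ K → 0 < g' i ∧ g' i ≤ γ)
    (hL : HistLipschitz Λ γ β) (hΛ : FadingMemory C θ Λ) (hsmall : 4 * C * γ ^ 3 ≤ (1 - θ) ^ 2)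
    (h0 : g 0 < g' 0) {j : ℕ} (hj : j ≤ K) :
    ((1 + θ) / 2) ^ j * (1 / (g 0) ^ 2 - 1 / (g' 0) ^ 2) ≤ 1 / (g j) ^ 2 - 1 / (g' j) ^ 2 := by
  have h := le_of_chain (Δ := fun j => 1 / (g j) ^ 2 - 1 / (g' j) ^ 2) (ρ := (1 + θ) / 2) (by linarith) j
    (fun i hi => sep_geometric hθ0 hθ1 hC hg hg' hbox hbox' hL hΛ hsmall h0 i (lt_of_lt_of_le hi hj)) 0 (Nat.zero_le _)
  simpa using h

/-- **ORDER IS PRESERVED AT EVERY SCALE.**  Under the hypotheses of `sep_geometric`: g_0 < g′_0 ⟹ g_j < g′_j for every j ≤ K — the order of the bare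
couplings is the order of every effective coupling, in particular of the renormalized ones g_K < g′_K.  Sign-free, AF-free, at any depth.
[cite: Balaban1987RG1, (0.20) p.256 with p.298] -/
theorem order_preserved {γ θ C : ℝ} {Λ : ℕ → ℕ → ℝ} {K : ℕ} {g g' : ℕ → ℝ}
    (hθ0 : 0 ≤ θ) (hθ1 : θ < 1) (hC : 0 ≤ C) (hg : RGEqH K β g) (hg' : RGEqH K β g')
    (hbox : ∀ i, i ≤ K → 0 < g i ∧ g i ≤ γ) (hbox' : ∀ i, i ≤ K → 0 < g' i ∧ g' i ≤ γ)
    (hL : HistLipschitz Λ γ β) (hΛ : FadingMemory C θ Λ) (hsmall : 4 * C * γ ^ 3 ≤ (1 - θ) ^ 2)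
    (h0 : g 0 < g' 0) : ∀ j, j ≤ K → g j < g' j := by
  intro j hj
  have hg0 := (hbox 0 (Nat.zero_le _)).1
  have hgj := (hbox j hj).1
  have hgj' := (hbox' j hj).1
  have hΔ0 : 0 < 1 / (g 0) ^ 2 - 1 / (g' 0) ^ 2 := by
    linarith [one_div_lt_one_div_of_lt (pow_pos hg0 2) (sq_lt_sq' (by linarith [(hbox' 0 (Nat.zero_le _)).1]) h0)]
  have h := sep_lower hθ0 hθ1 hC hg hg' hbox hbox' hL hΛ hsmall h0 hj
  have hpos : 0 < 1 / (g j) ^ 2 - 1 / (g' j) ^ 2 :=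
    lt_of_lt_of_le (mul_pos (pow_pos (by linarith) j) hΔ0) h
  have hsq : (g j) ^ 2 < (g' j) ^ 2 := (one_div_lt_one_div (pow_pos hgj' 2) (pow_pos hgj 2)).mp (by linarith)
  have := abs_lt_of_sq_lt_sq hsq hgj'.le
  rwa [abs_of_pos hgj] at this

/-- FORWARD UNIQUENESS (any β, no modulus): two positive solutions of (0.20) of length K with the same bare coupling coincide — (0.20) determines
1∕g_{k+1}² from the history, positivity determines g_{k+1} (`FlowStepRuns.flow_eq_of_rgEqH`). [cite: Balaban1987RG1, (0.20) p.256] -/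
theorem fwd_unique {K : ℕ} {g g' : ℕ → ℝ} (hg : RGEqH K β g) (hg' : RGEqH K β g')
    (hpos : ∀ i, i ≤ K → 0 < g i) (hpos' : ∀ i, i ≤ K → 0 < g' i) (h0 : g 0 = g' 0) :
    ∀ j, j ≤ K → g j = g' j :=
  FlowStepRuns.flow_eq_of_rgEqH ⟨g, fun _ _ => 0⟩ β K
    (fun k hk _ _ => ⟨hpos (k + 1) hk, by have := hg k hk; simp only at this ⊢; linarith⟩) h0 hg' hpos'

/-- **SAME-LENGTH UNIQUENESS, SIGN-FREE AND AF-FREE.**  Two runs of (0.20) of the SAME length K for one history-dependent β, couplings in ]0, γ], PINNED at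
the same renormalized value g_K = g′_K, coupling-chart moduli `HistLipschitz Λ γ β` with `FadingMemory C θ Λ` (0 ≤ θ < 1, 0 ≤ C) and `4Cγ³ ≤ (1 − θ)²`: the runs
coincide at every scale.  Prover 1's `…HistoryUnique.runs_eq_of_fadingMemory` WITHOUT the AF letter ∕ weight-sum bound ∕ b-dependent smallness (and with
θ = 0 allowed: then Λ is diagonal and this is `runs_eq_of_lastOnly` up to the constant).  Trichotomy on the bare couplings + `order_preserved` + `fwd_unique`.
[cite: Balaban1987RG1, Thm 2 p.259 («g₀ = g₀(ε, g)») with (0.20) p.256 and p.298] -/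
theorem runs_eq_of_fadingMemory_signFree {γ θ C : ℝ} {Λ : ℕ → ℕ → ℝ} {K : ℕ} {g g' : ℕ → ℝ}
    (hθ0 : 0 ≤ θ) (hθ1 : θ < 1) (hC : 0 ≤ C) (hg : RGEqH K β g) (hg' : RGEqH K β g')
    (hbox : ∀ i, i ≤ K → 0 < g i ∧ g i ≤ γ) (hbox' : ∀ i, i ≤ K → 0 < g' i ∧ g' i ≤ γ)
    (hL : HistLipschitz Λ γ β) (hΛ : FadingMemory C θ Λ) (hsmall : 4 * C * γ ^ 3 ≤ (1 - θ) ^ 2)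
    (hpin : g K = g' K) : ∀ j, j ≤ K → g j = g' j := by
  rcases lt_trichotomy (g 0) (g' 0) with hlt | heq | hgt
  · exact absurd hpin (ne_of_lt (order_preserved hθ0 hθ1 hC hg hg' hbox hbox' hL hΛ hsmall hlt K le_rfl))
  · exact fwd_unique hg hg' (fun i hi => (hbox i hi).1) (fun i hi => (hbox' i hi).1) heq
  · exact absurd hpin.symm (ne_of_lt (order_preserved hθ0 hθ1 hC hg' hg hbox' hbox hL hΛ hsmall hgt K le_rfl))

/-- **THE ENDPOINT MAP IS STRICTLY INCREASING**: under the moduli, for two in-box runs of the same length, g_0 < g′_0 ⟺ g_K < g′_K.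
[cite: Balaban1987RG1, Thm 2 p.259 («g₀ = g₀(ε, g)») with (0.20) p.256 and p.298] -/
theorem bare_lt_iff_end_lt {γ θ C : ℝ} {Λ : ℕ → ℕ → ℝ} {K : ℕ} {g g' : ℕ → ℝ}
    (hθ0 : 0 ≤ θ) (hθ1 : θ < 1) (hC : 0 ≤ C) (hg : RGEqH K β g) (hg' : RGEqH K β g')
    (hbox : ∀ i, i ≤ K → 0 < g i ∧ g i ≤ γ) (hbox' : ∀ i, i ≤ K → 0 < g' i ∧ g' i ≤ γ)
    (hL : HistLipschitz Λ γ β) (hΛ : FadingMemory C θ Λ) (hsmall : 4 * C * γ ^ 3 ≤ (1 - θ) ^ 2) :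
    g 0 < g' 0 ↔ g K < g' K := by
  refine ⟨fun h => order_preserved hθ0 hθ1 hC hg hg' hbox hbox' hL hΛ hsmall h K le_rfl, fun h => ?_⟩
  rcases lt_trichotomy (g 0) (g' 0) with hlt | heq | hgt
  · exact hlt
  · exact absurd (fwd_unique hg hg' (fun i hi => (hbox i hi).1) (fun i hi => (hbox' i hi).1) heq K le_rfl) (ne_of_lt h)
  · exact absurd h (not_lt.mpr (order_preserved hθ0 hθ1 hC hg' hg hbox' hbox hL hΛ hsmall hgt K le_rfl).le)

end General

/-! ## §2 On the as-printed carrier: «g₀ = g₀(ε, g)» is a strictly increasing FUNCTION under fading memory alone -/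

variable {S : Setting}

/-- **«g₀(ε, g)» IS A FUNCTION UNDER FADING MEMORY — NO AF LETTER.**  For a setting with the printed `Definitions` ((0.18): runs start at their bare coupling):
two runs (K, m, g₀), (K, m, g₀′) obeying (0.20), staying in ]0, γ] and ending at the SAME renormalized coupling have the SAME bare coupling (and coincide at
every scale), provided `HistLipschitz Λ γ S.β` with `FadingMemory C θ Λ` (0 ≤ θ < 1, 0 ≤ C) and `4Cγ³ ≤ (1 − θ)²`.  Prover 1's `bareCoupling_unique_of_fadingMemory`
with `BetaLowerH b` and `C(γ³ + 2γ∕b) ≤ (1−θ)∕2` REMOVED. [cite: Balaban1987RG1, Thm 2 p.259 («g₀ = g₀(ε, g)») with (0.18)–(0.20) pp.255–256 and p.298] -/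
theorem bareCoupling_unique_signFree (hD : Definitions S) {γ θ C : ℝ} {Λ : ℕ → ℕ → ℝ}
    (hθ0 : 0 ≤ θ) (hθ1 : θ < 1) (hC : 0 ≤ C) (hL : HistLipschitz Λ γ S.β) (hΛ : FadingMemory C θ Λ)
    (hsmall : 4 * C * γ ^ 3 ≤ (1 - θ) ^ 2) {K m : ℕ} {g₀ g₀' : ℝ}
    (hrg : RGEqH K S.β (S.cpl ⟨K, m, g₀⟩)) (hrg' : RGEqH K S.β (S.cpl ⟨K, m, g₀'⟩))
    (hI : Step.InInterval γ K (S.cpl ⟨K, m, g₀⟩)) (hI' : Step.InInterval γ K (S.cpl ⟨K, m, g₀'⟩))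
    (hpin : S.cpl ⟨K, m, g₀⟩ K = S.cpl ⟨K, m, g₀'⟩ K) :
    g₀ = g₀' ∧ ∀ j, j ≤ K → S.cpl ⟨K, m, g₀⟩ j = S.cpl ⟨K, m, g₀'⟩ j := by
  have hall := runs_eq_of_fadingMemory_signFree hθ0 hθ1 hC hrg hrg' hI hI' hL hΛ hsmall hpin
  refine ⟨?_, hall⟩
  have h0 := hall 0 (Nat.zero_le K)
  rwa [hD.d018, hD.d018] at h0

/-- **ORDER OF BARE COUPLINGS = ORDER OF EFFECTIVE COUPLINGS.**  Same letters as `bareCoupling_unique_signFree`: g₀ < g₀′ ⟹ g_j < g′_j at EVERY scale j ≤ K of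
two in-]0, γ]-interval runs of the same length obeying (0.20). [cite: Balaban1987RG1, Thm 2 p.259 («g₀ = g₀(ε, g)») with (0.18)–(0.20) pp.255–256 and p.298] -/
theorem bareCoupling_strictMono (hD : Definitions S) {γ θ C : ℝ} {Λ : ℕ → ℕ → ℝ}
    (hθ0 : 0 ≤ θ) (hθ1 : θ < 1) (hC : 0 ≤ C) (hL : HistLipschitz Λ γ S.β) (hΛ : FadingMemory C θ Λ)
    (hsmall : 4 * C * γ ^ 3 ≤ (1 - θ) ^ 2) {K m : ℕ} {g₀ g₀' : ℝ}
    (hrg : RGEqH K S.β (S.cpl ⟨K, m, g₀⟩)) (hrg' : RGEqH K S.β (S.cpl ⟨K, m, g₀'⟩))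
    (hI : Step.InInterval γ K (S.cpl ⟨K, m, g₀⟩)) (hI' : Step.InInterval γ K (S.cpl ⟨K, m, g₀'⟩))
    (hlt : g₀ < g₀') : ∀ j, j ≤ K → S.cpl ⟨K, m, g₀⟩ j < S.cpl ⟨K, m, g₀'⟩ j := by
  have h0 : S.cpl ⟨K, m, g₀⟩ 0 < S.cpl ⟨K, m, g₀'⟩ 0 := by rw [hD.d018, hD.d018]; exact hlt
  exact order_preserved hθ0 hθ1 hC hrg hrg' hI hI' hL hΛ hsmall h0

/-- **THE RENORMALIZED COUPLING IS A STRICTLY INCREASING FUNCTION OF THE BARE COUPLING** (same letters): g₀ < g₀′ ⟺ g_K < g′_K.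
[cite: Balaban1987RG1, Thm 2 p.259 («g₀ = g₀(ε, g)») with (0.18)–(0.20) pp.255–256 and p.298] -/
theorem bare_lt_iff_renormalized_lt (hD : Definitions S) {γ θ C : ℝ} {Λ : ℕ → ℕ → ℝ}
    (hθ0 : 0 ≤ θ) (hθ1 : θ < 1) (hC : 0 ≤ C) (hL : HistLipschitz Λ γ S.β) (hΛ : FadingMemory C θ Λ)
    (hsmall : 4 * C * γ ^ 3 ≤ (1 - θ) ^ 2) {K m : ℕ} {g₀ g₀' : ℝ}
    (hrg : RGEqH K S.β (S.cpl ⟨K, m, g₀⟩)) (hrg' : RGEqH K S.β (S.cpl ⟨K, m, g₀'⟩))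
    (hI : Step.InInterval γ K (S.cpl ⟨K, m, g₀⟩)) (hI' : Step.InInterval γ K (S.cpl ⟨K, m, g₀'⟩)) :
    g₀ < g₀' ↔ S.cpl ⟨K, m, g₀⟩ K < S.cpl ⟨K, m, g₀'⟩ K := by
  have h := bare_lt_iff_end_lt hθ0 hθ1 hC hrg hrg' hI hI' hL hΛ hsmall
  rwa [hD.d018, hD.d018] at h

/-- **LOCAL UNIQUENESS NEAR ZERO, FROM THE MODULI ALONE** — part 5's hypothesis `huniq` (`…PointwiseCover.betaAFH_of_uniformTheorem2_unique_histOsc`) and part 6's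
`exists_localUnique_of_fadingMemory` WITHOUT its tuned-run carrier `hT` (no Theorem 2, no (0.31), no b): `Definitions` + prover 1's binder `hrg` on ]0, γ_U] +
`HistLipschitz Λ γ_U S.β` with `FadingMemory C θ Λ` ⟹ there is g₂ > 0 (explicitly min(γ_U, 1, (1−θ)²∕(4C+1))) such that in-]0, g₂]-interval runs of the same
length with a common endpoint have the same bare coupling. [cite: Balaban1987RG1, Thm 2 p.259 («g₀ = g₀(ε, g)») with (0.18)–(0.20) pp.255–256 and p.298] -/
theorem localUnique_signFree (hD : Definitions S) {m : ℕ} {γU θ C : ℝ} {Λ : ℕ → ℕ → ℝ}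
    (hθ0 : 0 ≤ θ) (hθ1 : θ < 1) (hC : 0 ≤ C) (hγU : 0 < γU)
    (hrg : ∀ P : B12.RunParams, Step.InInterval γU P.K (S.cpl P) → RGEqH P.K S.β (S.cpl P))
    (hL : HistLipschitz Λ γU S.β) (hΛ : FadingMemory C θ Λ) :
    ∃ g₂ : ℝ, 0 < g₂ ∧ ∀ (K : ℕ) (g₀ g₀' : ℝ), Step.InInterval g₂ K (S.cpl ⟨K, m, g₀⟩) →
      Step.InInterval g₂ K (S.cpl ⟨K, m, g₀'⟩) → S.cpl ⟨K, m, g₀⟩ K = S.cpl ⟨K, m, g₀'⟩ K → g₀ = g₀' := by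
  have h1θ' : 0 < 1 - θ := by linarith
  have h1θ : 0 < (1 - θ) ^ 2 := by positivity
  set r : ℝ := (1 - θ) ^ 2 / (4 * C + 1) with hr
  have hrpos : 0 < r := by rw [hr]; positivity
  set g₂ : ℝ := min γU (min 1 r) with hg₂
  have hg₂pos : 0 < g₂ := lt_min hγU (lt_min one_pos hrpos)
  have hg₂U : g₂ ≤ γU := min_le_left _ _
  have hg₂1 : g₂ ≤ 1 := (min_le_right _ _).trans (min_le_left _ _)
  have hg₂r : g₂ ≤ r := (min_le_right _ _).trans (min_le_right _ _)
  have hsmall : 4 * C * g₂ ^ 3 ≤ (1 - θ) ^ 2 := by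
    have hcube : g₂ ^ 3 ≤ g₂ := by
      calc g₂ ^ 3 = g₂ * g₂ ^ 2 := by ring
        _ ≤ g₂ * 1 := mul_le_mul_of_nonneg_left (pow_le_one₀ hg₂pos.le hg₂1) hg₂pos.le
        _ = g₂ := mul_one _
    have h4C : 0 ≤ 4 * C := by positivity
    calc 4 * C * g₂ ^ 3 ≤ 4 * C * g₂ := mul_le_mul_of_nonneg_left hcube h4C
      _ ≤ 4 * C * r := mul_le_mul_of_nonneg_left hg₂r h4C
      _ = 4 * C * (1 - θ) ^ 2 / (4 * C + 1) := by rw [hr]; ring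
      _ ≤ (1 - θ) ^ 2 := by
          rw [div_le_iff₀ (by positivity)]; nlinarith
  refine ⟨g₂, hg₂pos, fun K g₀ g₀' hI hI' he => ?_⟩
  have hLg : HistLipschitz Λ g₂ S.β := fun k p q hp hq => hL k p q (box_mono hg₂U k hp) (box_mono hg₂U k hq)
  have hIU : Step.InInterval γU K (S.cpl ⟨K, m, g₀⟩) := fun i hi => ⟨(hI i hi).1, (hI i hi).2.trans hg₂U⟩
  have hIU' : Step.InInterval γU K (S.cpl ⟨K, m, g₀'⟩) := fun i hi => ⟨(hI' i hi).1, (hI' i hi).2.trans hg₂U⟩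
  exact (bareCoupling_unique_signFree hD hθ0 hθ1 hC hLg hΛ hsmall (hrg ⟨K, m, g₀⟩ hIU) (hrg ⟨K, m, g₀'⟩ hIU')
    hI hI' he).1

/-- **END — THEOREM 2's «g₀ = g₀(ε, g)» EXISTS AND IS UNIQUE UNDER FADING MEMORY, WITH NO ASYMPTOTIC-FREEDOM LETTER AND IN THE TYPED READING.**
`Theorem2Statement S hL` ([I] Theorem 2 AS PRINTED and AS TYPED — `Missing.B12Thm2Shape`: «there exist constants β, β′» AFTER «for a sufficiently small positive g»
— a HYPOTHESIS), the printed `Definitions`, the box-wide upper letter `β_{k+1} ≤ b′` on ]0, γ_u]^{k+1} (p. 264 «uniformly bounded»; used only to put (0.20) on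
in-interval runs, `…TunedUpper.hrg_of_betaUpperH`), coupling-chart moduli `HistLipschitz Λ γ_u S.β` with `FadingMemory C θ Λ` (0 ≤ θ < 1, 0 ≤ C), and ONE box size
γ₁ ≤ γ_u with b′γ₁² < 1 and 4Cγ₁³ ≤ (1 − θ)² ⟹ for every m there is γ₂ > 0 such that for every γ ≤ γ₂ there is g₁ > 0 such that for every g ∈ ]0, g₁] and EVERY K
there is EXACTLY ONE bare coupling g₀ whose run (K, m, g₀) stays in ]0, γ] and ends at g_K = g.  Prover 1's END `theorem2_existsUnique_of_fadingMemory` (#61e)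
WITHOUT `BetaLowerH b` (and 0 ≤ θ), part 6′'s `theorem2_existsUnique_of_uniformTheorem2_fadingMemory` (#60d) WITHOUT the uniform reading `hTu`: the g-uniform
placement of «∃ β, β′» is NOT load-bearing for uniqueness (it IS for size: #59e).  Existence is Theorem 2's; uniqueness is §1.  A REDUCTION over UNPRINTED
letters; nothing of [I] asserted. [cite: Balaban1987RG1, Thm 2 (0.31) p.259 with (0.20) p.256, §1 p.264 and p.298] -/
theorem theorem2_existsUnique_of_fadingMemory_signFree {hL : Odd S.L ∧ 1 < S.L} (h : Theorem2Statement S hL) (hD : Definitions S)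
    {γu γ₁ b' θ C : ℝ} {Λ : ℕ → ℕ → ℝ} (hup : BetaUpperH b' γu S.β)
    (hL' : HistLipschitz Λ γu S.β) (hΛ : FadingMemory C θ Λ) (hθ0 : 0 ≤ θ) (hθ1 : θ < 1) (hC : 0 ≤ C)
    (hγ₁ : 0 < γ₁) (hγ₁u : γ₁ ≤ γu) (hbu : b' * γ₁ ^ 2 < 1) (hsmall : 4 * C * γ₁ ^ 3 ≤ (1 - θ) ^ 2) (m : ℕ) :
    ∃ γ₂ : ℝ, 0 < γ₂ ∧ ∀ γ : ℝ, 0 < γ → γ ≤ γ₂ → ∃ g₁ : ℝ, 0 < g₁ ∧ ∀ g : ℝ, 0 < g → g ≤ g₁ → ∀ K : ℕ,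
      ∃! g₀ : ℝ, Step.InInterval γ K (S.cpl ⟨K, m, g₀⟩) ∧ S.cpl ⟨K, m, g₀⟩ K = g := by
  obtain ⟨γ₀, hγ₀, hγ⟩ := tunedRuns_of_theorem2Statement h m
  refine ⟨min γ₀ γ₁, lt_min hγ₀ hγ₁, fun γ hγpos hγle => ?_⟩
  have hγ₀le : γ ≤ γ₀ := hγle.trans (min_le_left _ _)
  have hγ₁le : γ ≤ γ₁ := hγle.trans (min_le_right _ _)
  have hγule : γ ≤ γu := hγ₁le.trans hγ₁u
  obtain ⟨g₁, hg₁, hg⟩ := hγ γ hγpos hγ₀le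
  refine ⟨g₁, hg₁, fun g hgpos hgle K => ?_⟩
  obtain ⟨β, β', -, -, hK⟩ := hg g hgpos hgle
  obtain ⟨g₀, hI, hend, -⟩ := hK K
  have hup' : BetaUpperH b' γ S.β := fun k v hv => hup k v (box_mono hγule k hv)
  have hLγ : HistLipschitz Λ γ S.β := fun k p q hp hq => hL' k p q (box_mono hγule k hp) (box_mono hγule k hq)
  have hγsq : γ ^ 2 ≤ γ₁ ^ 2 := pow_le_pow_left₀ hγpos.le hγ₁le 2
  have hbγ : b' * γ ^ 2 < 1 := by
    rcases le_or_gt 0 b' with hb' | hb'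
    · exact lt_of_le_of_lt (mul_le_mul_of_nonneg_left hγsq hb') hbu
    · nlinarith [sq_nonneg γ]
  have hsmallγ : 4 * C * γ ^ 3 ≤ (1 - θ) ^ 2 :=
    (mul_le_mul_of_nonneg_left (pow_le_pow_left₀ hγpos.le hγ₁le 3) (by positivity)).trans hsmall
  refine ⟨g₀, ⟨hI, hend⟩, fun y hy => ?_⟩
  obtain ⟨hIy, hendy⟩ := hy
  exact (bareCoupling_unique_signFree hD hθ0 hθ1 hC hLγ hΛ hsmallγ
    (hrg_of_betaUpperH hD hγpos hup' hbγ ⟨K, m, y⟩ hIy) (hrg_of_betaUpperH hD hγpos hup' hbγ ⟨K, m, g₀⟩ hI)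
    hIy hI (hendy.trans hend.symm)).1

end

end Summit.QuantumFields.BalabanUV.Beta.EriceFlowEnclosureB12AsPrintedPointwiseFadingOrder
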